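import Summits.RiemannHypothesis.RiemannHypothesis.Theorems.IntegerScrewCensusFastPack

/-!
# Route `IntegerScrew` — fast kernel arithmetic for manifest-certificate checks (7): the pair numerator identity

For two packed nodes `a, b` (rows `ra, rb` of offset fixed-point values `ẑ_{k,m} = (x_{km} + i y_{km})/2^52`, weights
`Ω_k`) the checker's quantity `POS + kdotS(uc_a, vc_b) + kdotS(us_a, vs_b) − (na_a + nb_b)` IS the exact numerator
`Num_ab = 2^104(ΣΩ + WJ) − 2^52 Σ_k Ω_k (x_{ka} + x_{kb}) + Σ_k Ω_k (x_{ka}x_{kb} + y_{ka}y_{kb})` of `2^164·P̂_ab`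
(the PSD part of the certificate evaluated on the stored trig values): `pair_num`.  The spec sums `Lc, Ls, Mc, Ms, Ecs, So`
and their identification with the packed digit sums / Kronecker dot products (`sumN_dWc`, …, `kdot_c`, `kdot_s`).
Pure integer arithmetic over `IntegerScrewCensusFastPack`; RH-free and ζ-free; nothing here bears on the truth of RH.
-/

set_option linter.dupNamespace false
set_option autoImplicit false

namespace Summit.RiemannHypothesis.RiemannHypothesis.Theorems.IntegerScrew.Manifest.Fast

open Finset
open Literature.Analysis.ValidatedNumerics Literature.Analysis.ValidatedNumerics.Numerics
open Literature.Analysis.ValidatedNumerics.KroneckerDot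

/-! ### Spec sums of a row -/

/-- `x_k` of a row: the stored cos value (integer) of atom `k`. -/
def xv (r : List (ℕ × ℕ)) (k : ℕ) : ℤ := oval (r.getD k (0, 0)).1
/-- `y_k` of a row: the stored sin value (integer) of atom `k`. -/
def yv (r : List (ℕ × ℕ)) (k : ℕ) : ℤ := oval (r.getD k (0, 0)).2
/-- `Ω_k` as an integer. -/
def omv (oms : List ℕ) (k : ℕ) : ℤ := (oms.getD k 0 : ℤ)

/-- `Σ_k Ω_k x_k`. -/
def Lc (oms : List ℕ) (r : List (ℕ × ℕ)) (K : ℕ) : ℤ := ∑ k ∈ range K, omv oms k * xv r k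
/-- `Σ_k Ω_k y_k`. -/
def Ls (oms : List ℕ) (r : List (ℕ × ℕ)) (K : ℕ) : ℤ := ∑ k ∈ range K, omv oms k * yv r k
/-- `Σ_k x_k`. -/
def Mc (r : List (ℕ × ℕ)) (K : ℕ) : ℤ := ∑ k ∈ range K, xv r k
/-- `Σ_k y_k`. -/
def Ms (r : List (ℕ × ℕ)) (K : ℕ) : ℤ := ∑ k ∈ range K, yv r k
/-- `Σ_k Ω_k (x_{ka} x_{kb} + y_{ka} y_{kb})`. -/
def Ecs (oms : List ℕ) (ra rb : List (ℕ × ℕ)) (K : ℕ) : ℤ :=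
  ∑ k ∈ range K, omv oms k * (xv ra k * xv rb k + yv ra k * yv rb k)
/-- `Σ_k Ω_k` as an integer sum. -/
def So (oms : List ℕ) (K : ℕ) : ℤ := ∑ k ∈ range K, omv oms k

/-- **The exact numerator** `Num_ab = 2^104(ΣΩ + WJ) − 2^52(L_a + L_b) + E_ab` of `2^164·P̂_ab`. -/
def Num (oms : List ℕ) (ra rb : List (ℕ × ℕ)) (K WJ : ℕ) : ℤ :=
  2 ^ 104 * (So oms K + WJ) - 2 ^ 52 * (Lc oms ra K + Lc oms rb K) + Ecs oms ra rb K

/-- Expansion of a product sum with offsets. -/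
theorem sum_offset_mul (o f g : ℕ → ℤ) (A B : ℤ) : ∀ K : ℕ,
    ∑ k ∈ range K, (o k * f k + A) * (g k + B) =
      ∑ k ∈ range K, o k * (f k * g k) + B * ∑ k ∈ range K, o k * f k + A * ∑ k ∈ range K, g k + K * (A * B)
  | 0 => by simp
  | K + 1 => by
    simp only [Finset.sum_range_succ, sum_offset_mul o f g A B K]
    push_cast
    ring

section Pair

variable {oms : List ℕ} {ra rb : List (ℕ × ℕ)} {K : ℕ}

/-- Pointwise smallness from `OmSmall`/`RowSmall` at an index. -/
theorem small_at {r : List (ℕ × ℕ)} (ho : OmSmall oms) (hr : RowSmall r) (hK : oms.length = K) (hrl : r.length = K)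
    {k : ℕ} (hk : k < K) :
    oms.getD k 0 < 2 ^ 60 ∧ |oval (r.getD k (0, 0)).1| ≤ 2 ^ 53 ∧ |oval (r.getD k (0, 0)).2| ≤ 2 ^ 53 := by
  have h1 : oms.getD k 0 ∈ oms := by
    rw [List.getD_eq_getElem _ _ (by omega)]; exact List.getElem_mem _
  have h2 : r.getD k (0, 0) ∈ r := by
    rw [List.getD_eq_getElem _ _ (by omega)]; exact List.getElem_mem _
  exact ⟨ho _ h1, (hr _ h2).1, (hr _ h2).2⟩

/-- `Σ Ω` as `sumN`. -/
theorem sumN_oms (hK : oms.length = K) : (sumN oms : ℤ) = So oms K := by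
  rw [sumN_eq_sum, hK, Nat.cast_sum]; rfl

/-- `sumN (dWc) = L_c + K·D0`. -/
theorem sumN_dWc (ho : OmSmall oms) (hr : RowSmall ra) (hK : oms.length = K) (hra : ra.length = K) :
    (sumN (dWc oms ra) : ℤ) = Lc oms ra K + K * D0 := by
  rw [sumN_eq_sum, length_dWc, hK, hra, Nat.min_self, Nat.cast_sum]
  have h : ∀ i ∈ range K, (((dWc oms ra).getD i 0 : ℕ) : ℤ) = omv oms i * xv ra i + D0 := by
    intro i hi
    rw [Finset.mem_range] at hi
    obtain ⟨h1, h2, -⟩ := small_at ho hr hK hra hi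
    rw [getD_dWc (by omega) (by omega), digW_eq h1 h2]; rfl
  rw [Finset.sum_congr rfl h, Finset.sum_add_distrib, Finset.sum_const, Finset.card_range]
  simp [Lc]

/-- `sumN (dWs) = L_s + K·D0`. -/
theorem sumN_dWs (ho : OmSmall oms) (hr : RowSmall ra) (hK : oms.length = K) (hra : ra.length = K) :
    (sumN (dWs oms ra) : ℤ) = Ls oms ra K + K * D0 := by
  rw [sumN_eq_sum, length_dWs, hK, hra, Nat.min_self, Nat.cast_sum]
  have h : ∀ i ∈ range K, (((dWs oms ra).getD i 0 : ℕ) : ℤ) = omv oms i * yv ra i + D0 := by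
    intro i hi
    rw [Finset.mem_range] at hi
    obtain ⟨h1, -, h3⟩ := small_at ho hr hK hra hi
    rw [getD_dWs (by omega) (by omega), digW_eq h1 h3]; rfl
  rw [Finset.sum_congr rfl h, Finset.sum_add_distrib, Finset.sum_const, Finset.card_range]
  simp [Ls]

/-- `sumN (dPc) = M_c + K·D1`. -/
theorem sumN_dPc (ho : OmSmall oms) (hr : RowSmall rb) (hK : oms.length = K) (hrb : rb.length = K) :
    (sumN (dPc rb) : ℤ) = Mc rb K + K * D1 := by
  rw [sumN_eq_sum, length_dPc, hrb, Nat.cast_sum]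
  have h : ∀ i ∈ range K, (((dPc rb).getD i 0 : ℕ) : ℤ) = xv rb i + D1 := by
    intro i hi
    rw [Finset.mem_range] at hi
    obtain ⟨-, h2, -⟩ := small_at ho hr hK hrb hi
    rw [getD_dPc (by omega), digP_eq h2]; rfl
  rw [Finset.sum_congr rfl h, Finset.sum_add_distrib, Finset.sum_const, Finset.card_range]
  simp [Mc]

/-- `sumN (dPs) = M_s + K·D1`. -/
theorem sumN_dPs (ho : OmSmall oms) (hr : RowSmall rb) (hK : oms.length = K) (hrb : rb.length = K) :
    (sumN (dPs rb) : ℤ) = Ms rb K + K * D1 := by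
  rw [sumN_eq_sum, length_dPs, hrb, Nat.cast_sum]
  have h : ∀ i ∈ range K, (((dPs rb).getD i 0 : ℕ) : ℤ) = yv rb i + D1 := by
    intro i hi
    rw [Finset.mem_range] at hi
    obtain ⟨-, -, h3⟩ := small_at ho hr hK hrb hi
    rw [getD_dPs (by omega), digP_eq h3]; rfl
  rw [Finset.sum_congr rfl h, Finset.sum_add_distrib, Finset.sum_const, Finset.card_range]
  simp [Ms]

/-- **The cos dot product**: `kdotS(uc_a, vc_b) = Σ_k (Ω_k x_{ka} + D0)(x_{kb} + D1)`. -/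
theorem kdot_c (hK1 : 1 ≤ K) (hK2 : K ≤ 512) (ho : OmSmall oms) (hra : RowSmall ra) (hrb : RowSmall rb)
    (hK : oms.length = K) (hla : ra.length = K) (hlb : rb.length = K) :
    (kdotS (WB * (K - 1)) (packN WS (dWc oms ra)) (packRevN WS K (dPc rb)) : ℤ) =
      ∑ k ∈ range K, (omv oms k * xv ra k + D0) * (xv rb k + D1) := by
  rw [kdotS_pack hK1 hK2 (by rw [length_dWc]; omega) (by rw [length_dPc]; omega) (dWc_bound ho hra) (dPc_bound hrb),
    Nat.cast_sum]
  refine Finset.sum_congr rfl fun i hi => ?_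
  rw [Finset.mem_range] at hi
  obtain ⟨h1, h2, -⟩ := small_at ho hra hK hla hi
  obtain ⟨-, h4, -⟩ := small_at ho hrb hK hlb hi
  push_cast
  rw [getD_dWc (by omega) (by omega), getD_dPc (by omega), digW_eq h1 h2, digP_eq h4]
  rfl

/-- **The sin dot product**: `kdotS(us_a, vs_b) = Σ_k (Ω_k y_{ka} + D0)(y_{kb} + D1)`. -/
theorem kdot_s (hK1 : 1 ≤ K) (hK2 : K ≤ 512) (ho : OmSmall oms) (hra : RowSmall ra) (hrb : RowSmall rb)
    (hK : oms.length = K) (hla : ra.length = K) (hlb : rb.length = K) :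
    (kdotS (WB * (K - 1)) (packN WS (dWs oms ra)) (packRevN WS K (dPs rb)) : ℤ) =
      ∑ k ∈ range K, (omv oms k * yv ra k + D0) * (yv rb k + D1) := by
  rw [kdotS_pack hK1 hK2 (by rw [length_dWs]; omega) (by rw [length_dPs]; omega) (dWs_bound ho hra) (dPs_bound hrb),
    Nat.cast_sum]
  refine Finset.sum_congr rfl fun i hi => ?_
  rw [Finset.mem_range] at hi
  obtain ⟨h1, -, h3⟩ := small_at ho hra hK hla hi
  obtain ⟨-, -, h6⟩ := small_at ho hrb hK hlb hi
  push_cast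
  rw [getD_dWs (by omega) (by omega), getD_dPs (by omega), digW_eq h1 h3, digP_eq h6]
  rfl

/-- **The pair numerator identity.**  For the packed nodes `Pa = packNodeB E1 Ω (d_a, ra) u_a`,
`Pb = packNodeB E1 Ω (d_b, rb) u_b` (`K` atoms):
`kc + ks + POS − (na_a + nb_b) = Num_ab` with `POS = 2^104(ΣΩ + WJ) + 2K·D0·D1 + 2^53·K·D0`,
`na = D1(lwc + lws) + 2^52 lwc`, `nb = D0(mpc + mps) + 2^52 lwc`. -/
theorem pair_num (hK1 : 1 ≤ K) (hK2 : K ≤ 512) (ho : OmSmall oms) (hra : RowSmall ra) (hrb : RowSmall rb)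
    (hK : oms.length = K) (hla : ra.length = K) (hlb : rb.length = K) (E1 da db WJ : ℕ) (ua ub : ℕ × ℕ) :
    ((kdotS (WB * (K - 1)) (packNodeB E1 oms (da, ra) ua).uc (packNodeB E1 oms (db, rb) ub).vc : ℕ) : ℤ) +
        (kdotS (WB * (K - 1)) (packNodeB E1 oms (da, ra) ua).us (packNodeB E1 oms (db, rb) ub).vs : ℕ) +
        (2 ^ 104 * ((sumN oms : ℤ) + WJ) + 2 * K * D0 * D1 + 2 ^ 53 * K * D0) -
        ((D1 * (((packNodeB E1 oms (da, ra) ua).lwc : ℤ) + (packNodeB E1 oms (da, ra) ua).lws) +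
            SCL * (packNodeB E1 oms (da, ra) ua).lwc) +
          (D0 * (((packNodeB E1 oms (db, rb) ub).mpc : ℤ) + (packNodeB E1 oms (db, rb) ub).mps) +
            SCL * (packNodeB E1 oms (db, rb) ub).lwc)) =
      Num oms ra rb K WJ := by
  simp only [packNodeB_eq, packW_eq, packPB_eq, hlb]
  rw [kdot_c hK1 hK2 ho hra hrb hK hla hlb, kdot_s hK1 hK2 ho hra hrb hK hla hlb, sumN_dWc ho hra hK hla,
    sumN_dWs ho hra hK hla, sumN_dPc ho hrb hK hlb, sumN_dPs ho hrb hK hlb, sumN_dWc ho hrb hK hlb, sumN_oms hK,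
    sum_offset_mul, sum_offset_mul, SCL_val]
  unfold Num Ecs Lc Ls Mc Ms
  rw [show ∑ k ∈ range K, omv oms k * (xv ra k * xv rb k + yv ra k * yv rb k) =
      ∑ k ∈ range K, omv oms k * (xv ra k * xv rb k) + ∑ k ∈ range K, omv oms k * (yv ra k * yv rb k) by
    rw [← Finset.sum_add_distrib]; exact Finset.sum_congr rfl fun k _ => by ring]
  ring

end Pair

end Summit.RiemannHypothesis.RiemannHypothesis.Theorems.IntegerScrew.Manifest.Fast
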